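/-
Copyright (c) 2026 the pub-hodgecm-mathlib formalisation cell (harness21).  Prover seat hodgecm-mathlib-F0P3a-p06-g25 (PLACE-FREE LAYER after RIDER 2b; `hd ↦ hϖ` substitution
certified by «LH5» LH5-p04 (g10); LEAD F0P3a-plan (g16) T15-25 (b)(c), T15-30 (i); G-row LEDGER v13 OPEN item); 2026-09-03.
-/
import Summits.HodgeConjecture.HodgeConjecture.Theorems.F0P3cStCharTSEPTraces            -- ★ F p853248 (this seat): `epShape_eq`, the conjugate character (all `hd`-free); brings ★ A–E, ST-TWIST, (G3)-EXPLICIT, (G5) A, INDIC, CLASS-LINEAR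
import Summits.HodgeConjecture.HodgeConjecture.Theorems.F0P3cStCharTSStIwahoriHeadsPF    -- P2b (this seat): `dim St^{I}`, `St^{K₁} = 0` over `hϖ`; brings P2a, P1
import HarnessLib

/-!
# F0 · P3c · line LH6 «StCharTS» — PLACE-FREE LAYER P3 «EP-TRACES-PF»: the Euler–Poincaré trace table over the uniformiser token `hϖ : |ϖ|_w = exp(−1)` alone
# `Tr St_G(ψ)(f_EP) = −[ψ = 1]`, `Tr (ψ∘det_G)(f_EP) = [ψ = 1]`, `Tr St_G(ψ)(f_{St ψ′}) = [ψ = ψ′]`, `Tr St_G(ψ)(f_{det ψ′}) = −[ψ = ψ′]`, `Tr (ψ∘det_G)(f_{det ψ′}) = [ψ = ψ′]`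

Cell `pub/hodgecm-mathlib` (D-0151), FLOOR 0, crux item H413 = `stmt-HodgeConjecture-24833` (`--supports` lane, helper; seat F0P3a-p06 (g25)).  THEOREMS ONLY.  ★ F §2 and
★ G §1 with `hd ↦ hϖ : Valued.v ϖ = WithZero.exp (-1 : ℤ)` (the uniformiser token of ★ EXPLICIT-RAM ∕ ★ NOT-WILD p853198), proofs unchanged but reading the place-free
ranks P2b ∕ P1; every `hd`-free input (★ F §1∕§3, ★ B, ★ (G3)-EXPLICIT (c1)(c2), ★ INDIC, ★ CLASS-LINEAR, ★ ST-TWIST) is imported by name.  Valid at EVERY non-split `v`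
(unramified or tamely ramified) carrying the displayed `f_EP`.
HONEST LABEL: count-neutral helper layer (the guard widening of 2b from `Algebra.IsUnramifiedIn` to «not wild» is a later ONE-TOKEN rider on the LEAD's word); ★ files
untouched; closes no node; HC_CM is proved only modulo the 7 printed citations (hLiu418 = stmt-HodgeConjecture-24832, h413 = stmt-HodgeConjecture-24833) until rung 0 closes.

## References
* [Rogawski1990] J. D. Rogawski, *Automorphic Representations of Unitary Groups in Three Variables*, Ann. of Math. Stud. 123 (1990), §12.6 Prop. 12.6.1 (b) p. 188; §12.2 (1) p. 173.
* [Kottwitz1988] R. E. Kottwitz, *Tamagawa numbers*, Ann. of Math. 127 (1988), §2 Theorem 2.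
* [BushnellHenniart2006] C. J. Bushnell, G. Henniart, *The Local Langlands Conjecture for GL(2)* (2006), §9.5 (9.5.1) p. 65.
-/

set_option autoImplicit false
-- the mandated namespace has the single-problem summit's repeated segment (`HodgeConjecture.HodgeConjecture`)
set_option linter.dupNamespace false

noncomputable section

open NumberField IsDedekindDomain MeasureTheory Topology
open scoped Matrix MatrixGroups NNReal WithZero ComplexConjugate
open Literature.NumberTheory.Automorphic Literature.NumberTheory.Automorphic.UnitaryGroup
open Literature.NumberTheory.Rogawski1990 Literature.NumberTheory.Rogawski1990.Ch12Sec5 Literature.NumberTheory.GaloisRepresentations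
open Summit.HodgeConjecture.HodgeConjecture.Cruxes.H413.F0P3cStCharTSTorusDefs

namespace Summit.HodgeConjecture.HodgeConjecture.Cruxes.H413.F0P3cStCharTSEPTracesPF

open Summit.HodgeConjecture.HodgeConjecture.Cruxes.H413
open Summit.HodgeConjecture.HodgeConjecture.Cruxes.H413.F0P3cStCharTSStParahoricFixed
open Summit.HodgeConjecture.HodgeConjecture.Cruxes.H413.F0P3cStCharTSStNoSpherical
open Summit.HodgeConjecture.HodgeConjecture.Cruxes.H413.F0P3cStCharTSStTwist
open Summit.HodgeConjecture.HodgeConjecture.Cruxes.H413.F0P3cStCharTSEPGlueGExplicit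
open Summit.HodgeConjecture.HodgeConjecture.Cruxes.H413.F0P3cStCharTSEPPseudoCoeffSt (norm_centerChar_eq_one)
open Summit.HodgeConjecture.HodgeConjecture.Cruxes.H413.F0P3cStCharTSScTracePackage (isAdmissible_smoothIrrep)

variable (L : Type) [Field L] [NumberField L] [IsCMField L] (v : HeightOneSpectrum (𝓞 ↥(maximalRealSubfield L)))
  (w : PlacesOver L v) (hw : IsCMField.complexConj L • w.1 = w.1)
  (eA : Gqs L v ≃ₜ* ↥(unitaryGroupOfForm (galAdicCompletionMap (L := L) (IsCMField.complexConj L) hw) ((StdForm.antidiagonal 3).over (w.1.adicCompletion L))))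
  (heA : ∀ g : Gqs L v,
    ((eA g : ↥(unitaryGroupOfForm (galAdicCompletionMap (L := L) (IsCMField.complexConj L) hw) ((StdForm.antidiagonal 3).over (w.1.adicCompletion L)))) : GL (Fin 3) (w.1.adicCompletion L)) =
      ((localNonsplitEquiv (IsCMField.complexConj L) (qsForm L) (IsCMField.complexConj_ne_one L) w hw g :
        ↥(unitaryGroupOfForm (galAdicCompletionMap (L := L) (IsCMField.complexConj L) hw) (placeForm (qsForm L) w.1))) : GL (Fin 3) (w.1.adicCompletion L)))

/-! ## §2 `Tr St_G(ψ)(f_EP) = −[ψ = 1]` and `Tr (ψ∘det_G)(f_EP) = [ψ = 1]` -/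

include heA in
open Classical in
set_option maxHeartbeats 1600000 in
set_option synthInstance.maxHeartbeats 400000 in
-- instance-path unification between `Gqs L v` and the literal carrier of ★ `cmPrincipalSeries`
/-- **`Tr St_G(ψ)(f_EP^G) = dim^{K₀} + dim^{K₁} − dim^{I} = 0 + 0 − [ψ = 1]`** (★ INDIC `smoothTrace_mk_epShape` at any representative — all classes of `U(Φ₃)(L⁺_v)` are admissible —,
FILE B at `K₀ = K_v` (FILE C `F0P3cStCharTSStLevelsTransport.mem_K0_iff_mem_integralLevel`), FILE E at `K₁` and `I`). [cite: Rogawski1990, §12.6 Prop. 12.6.1 (b) p. 188; §12.2 (1) p. 173] [cite: Kottwitz1988, §2 Theorem 2] -/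
theorem smoothTrace_stG_ep (hns : ∀ w' : PlacesOver L v, IsCMField.complexConj L • w'.1 = w'.1) {ϖ : w.1.adicCompletion L}
    (hϖ : Valued.v ϖ = WithZero.exp (-1 : ℤ))
    (g₁ : GL (Fin 3) (w.1.adicCompletion L)) (hg₁ : (g₁ : Matrix (Fin 3) (Fin 3) (w.1.adicCompletion L)) = Matrix.diagonal ![(1 : w.1.adicCompletion L), 1, ϖ])
    (K0 K1 I : Subgroup (Gqs L v))
    (hK0 : K0 = ((glInt 3 (w.1.adicCompletion L)).subgroupOf
      (unitaryGroupOfForm (galAdicCompletionMap (L := L) (IsCMField.complexConj L) hw) ((StdForm.antidiagonal 3).over (w.1.adicCompletion L)))).comap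
        eA.toMulEquiv.toMonoidHom)
    (hK1 : K1 = (((glInt 3 (w.1.adicCompletion L)).map (MulAut.conj g₁).toMonoidHom).subgroupOf
      (unitaryGroupOfForm (galAdicCompletionMap (L := L) (IsCMField.complexConj L) hw) ((StdForm.antidiagonal 3).over (w.1.adicCompletion L)))).comap
        eA.toMulEquiv.toMonoidHom)
    (hI : I = K0 ⊓ K1)
    [MeasurableSpace (Gqs L v)] [BorelSpace (Gqs L v)] (νQv : Measure (Gqs L v)) [νQv.IsHaarMeasure]
    (fG : Gqs L v → ℂ)
    (hfG : fG = fun g => (((νQv K0).toReal : ℂ))⁻¹ * (K0 : Set (Gqs L v)).indicator (fun _ => (1 : ℂ)) g +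
      (((νQv K1).toReal : ℂ))⁻¹ * (K1 : Set (Gqs L v)).indicator (fun _ => (1 : ℂ)) g -
      (((νQv I).toReal : ℂ))⁻¹ * (I : Set (Gqs L v)).indicator (fun _ => (1 : ℂ)) g)
    (ι : ↥(normOneUnits (conjLocal L (IsCMField.complexConj L) v)) →* ↥(Subgroup.center (Gqs L v))) (hιc : Continuous ι)
    (hι : ∀ z : ↥(normOneUnits (conjLocal L (IsCMField.complexConj L) v)),
      ((ι z).val.val.val : Matrix (Fin 3) (Fin 3) (LocalRing L v)) = (((z : (LocalRing L v)ˣ) : LocalRing L v)) • (1 : Matrix (Fin 3) (Fin 3) (LocalRing L v)))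
    (detZ : Gqs L v →* ↥(Subgroup.center (Gqs L v)))
    (hdetZ : ∀ g : Gqs L v, ((detZ g).val.val.val : Matrix (Fin 3) (Fin 3) (LocalRing L v)) =
        (g.val.val : Matrix (Fin 3) (Fin 3) (LocalRing L v)).det • (1 : Matrix (Fin 3) (Fin 3) (LocalRing L v)))
    (stG detG : (↥(Subgroup.center (Gqs L v)) →* ℂˣ) → IrrClass (Gqs L v))
    (ψ : ↥(Subgroup.center (Gqs L v)) →* ℂˣ) (hψ : Continuous ψ)
    (hopen : IsOpen (((ψ.comp detZ).ker : Subgroup (Gqs L v)) : Set (Gqs L v)))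
    (hdet : detG ψ = IrrClass.mk (SmoothIrrep.ofChar (ψ.comp detZ) hopen))
    (hne : stG ψ ≠ detG ψ)
    (hJH : ∀ c : IrrClass (Gqs L v),
      c.IsConstituentOf (cmPrincipalSeries L 3 v
        (cmTorusCharPair L v (halfModulusChar (LocalRing L v) * halfModulusChar (LocalRing L v))⁻¹ (ψ.comp ι))) ↔ (c = stG ψ ∨ c = detG ψ)) :
    (stG ψ).smoothTrace νQv fG = -(if ψ = 1 then 1 else 0) := by
  haveI : NonarchimedeanGroup (Gqs L v) := nonarchimedeanGroup_cmLocal L 3 v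
  haveI : LocallyCompactSpace (Gqs L v) := locallyCompactSpace_cmDatum_local (L := L) (N := 3) (H := qsForm L) (v := v)
  obtain ⟨r, hr⟩ := IrrClass.mk_surjective (stG ψ)
  obtain ⟨hK0o, hK0c, hK1o, hK1c, hIo, hIc⟩ := isOpen_isCompact_epLevels L v w hw g₁ eA K0 K1 I hK0 hK1 hI
  obtain ⟨hμ0, hμ1, hμI⟩ := measureReal_epLevels_ne_zero L v w hw g₁ eA K0 K1 I hK0 hK1 hI νQv
  have hshape := IrrClass.smoothTrace_mk_epShape νQv r (isAdmissible_smoothIrrep L v hns r) hK0o hK0c hK1o hK1c hIo hIc hμ0 hμ1 hμI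
  rw [hfG, F0P3cStCharTSEPTraces.epShape_eq, ← hr, hshape]
  -- the three counts
  have hK0' : K0 = cmLocalIntegralLevel L 3 (qsForm L) v := Subgroup.ext fun g => F0P3cStCharTSStLevelsTransport.mem_K0_iff_mem_integralLevel L v w hw eA heA K0 hK0 g
  have h0 : Module.finrank ℂ (r.ρ.fixedPoints K0) = 0 := by
    rw [hK0']
    exact finrank_fixedPoints_st_integralLevel_eq_zero L v hns ι hιc hι detZ hdetZ stG detG ψ hψ hopen hdet hne hJH r hr
  have h1 : Module.finrank ℂ (r.ρ.fixedPoints K1) = 0 :=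
    F0P3cStCharTSStIwahoriHeadsPF.finrank_fixedPoints_st_K1_eq_zero L v w hw eA heA hns hϖ g₁ hg₁ K0 K1 I hK0 hK1 hI ι hιc hι detZ hdetZ stG detG ψ hψ hopen hdet hne hJH r hr
  have h2 : Module.finrank ℂ (r.ρ.fixedPoints I) = if ψ = 1 then 1 else 0 :=
    F0P3cStCharTSStIwahoriHeadsPF.finrank_fixedPoints_st_I L v w hw eA heA hns hϖ g₁ hg₁ K0 K1 I hK0 hK1 hI ι hιc hι detZ hdetZ stG detG ψ hψ hopen hdet hne hJH r hr
  rw [h0, h1, h2]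
  split_ifs <;> simp

include heA in
open Classical in
/-- **`Tr (ψ∘det_G)(f_EP^G) = [ψ = 1]·(1 + 1 − 1) = [ψ = 1]`** (★ INDIC at the representative `𝟙 ⊗ ψ∘detZ` of the pin clause `hdet`; FILE A `finrank_fixedPoints_ofChar` and H2
«DET-LEVELS» `comp_detZ_eq_one_on_iff` at `K₀ ≥ I`, `K₁ ≥ I`, `I ∋ d(1,b,1)` (FILE C)). [cite: Rogawski1990, §12.6 Prop. 12.6.1 (b) p. 188; §12.2 (1) p. 173] [cite: Kottwitz1988, §2 Theorem 2] -/
theorem smoothTrace_detG_ep (hns : ∀ w' : PlacesOver L v, IsCMField.complexConj L • w'.1 = w'.1) {ϖ : w.1.adicCompletion L}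
    (hϖ : Valued.v ϖ = WithZero.exp (-1 : ℤ))
    (g₁ : GL (Fin 3) (w.1.adicCompletion L)) (hg₁ : (g₁ : Matrix (Fin 3) (Fin 3) (w.1.adicCompletion L)) = Matrix.diagonal ![(1 : w.1.adicCompletion L), 1, ϖ])
    (K0 K1 I : Subgroup (Gqs L v))
    (hK0 : K0 = ((glInt 3 (w.1.adicCompletion L)).subgroupOf
      (unitaryGroupOfForm (galAdicCompletionMap (L := L) (IsCMField.complexConj L) hw) ((StdForm.antidiagonal 3).over (w.1.adicCompletion L)))).comap
        eA.toMulEquiv.toMonoidHom)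
    (hK1 : K1 = (((glInt 3 (w.1.adicCompletion L)).map (MulAut.conj g₁).toMonoidHom).subgroupOf
      (unitaryGroupOfForm (galAdicCompletionMap (L := L) (IsCMField.complexConj L) hw) ((StdForm.antidiagonal 3).over (w.1.adicCompletion L)))).comap
        eA.toMulEquiv.toMonoidHom)
    (hI : I = K0 ⊓ K1)
    [MeasurableSpace (Gqs L v)] [BorelSpace (Gqs L v)] (νQv : Measure (Gqs L v)) [νQv.IsHaarMeasure]
    (fG : Gqs L v → ℂ)
    (hfG : fG = fun g => (((νQv K0).toReal : ℂ))⁻¹ * (K0 : Set (Gqs L v)).indicator (fun _ => (1 : ℂ)) g +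
      (((νQv K1).toReal : ℂ))⁻¹ * (K1 : Set (Gqs L v)).indicator (fun _ => (1 : ℂ)) g -
      (((νQv I).toReal : ℂ))⁻¹ * (I : Set (Gqs L v)).indicator (fun _ => (1 : ℂ)) g)
    (ι : ↥(normOneUnits (conjLocal L (IsCMField.complexConj L) v)) →* ↥(Subgroup.center (Gqs L v)))
    (hι : ∀ z : ↥(normOneUnits (conjLocal L (IsCMField.complexConj L) v)),
      ((ι z).val.val.val : Matrix (Fin 3) (Fin 3) (LocalRing L v)) = (((z : (LocalRing L v)ˣ) : LocalRing L v)) • (1 : Matrix (Fin 3) (Fin 3) (LocalRing L v)))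
    (detZ : Gqs L v →* ↥(Subgroup.center (Gqs L v)))
    (hdetZ : ∀ g : Gqs L v, ((detZ g).val.val.val : Matrix (Fin 3) (Fin 3) (LocalRing L v)) =
        (g.val.val : Matrix (Fin 3) (Fin 3) (LocalRing L v)).det • (1 : Matrix (Fin 3) (Fin 3) (LocalRing L v)))
    (detG : (↥(Subgroup.center (Gqs L v)) →* ℂˣ) → IrrClass (Gqs L v))
    (ψ : ↥(Subgroup.center (Gqs L v)) →* ℂˣ)
    (hopen : IsOpen (((ψ.comp detZ).ker : Subgroup (Gqs L v)) : Set (Gqs L v)))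
    (hdet : detG ψ = IrrClass.mk (SmoothIrrep.ofChar (ψ.comp detZ) hopen)) :
    (detG ψ).smoothTrace νQv fG = if ψ = 1 then 1 else 0 := by
  haveI : NonarchimedeanGroup (Gqs L v) := nonarchimedeanGroup_cmLocal L 3 v
  haveI : LocallyCompactSpace (Gqs L v) := locallyCompactSpace_cmDatum_local (L := L) (N := 3) (H := qsForm L) (v := v)
  obtain ⟨hK0o, hK0c, hK1o, hK1c, hIo, hIc⟩ := isOpen_isCompact_epLevels L v w hw g₁ eA K0 K1 I hK0 hK1 hI
  obtain ⟨hμ0, hμ1, hμI⟩ := measureReal_epLevels_ne_zero L v w hw g₁ eA K0 K1 I hK0 hK1 hI νQv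
  have hshape := IrrClass.smoothTrace_mk_epShape νQv (SmoothIrrep.ofChar (ψ.comp detZ) hopen)
    (isAdmissible_smoothIrrep L v hns _) hK0o hK0c hK1o hK1c hIo hIc hμ0 hμ1 hμI
  rw [hfG, F0P3cStCharTSEPTraces.epShape_eq, hdet, hshape, finrank_fixedPoints_ofChar (ψ.comp detZ) hopen K0, finrank_fixedPoints_ofChar (ψ.comp detZ) hopen K1,
    finrank_fixedPoints_ofChar (ψ.comp detZ) hopen I]
  -- H2 «DET-LEVELS» at the three levels (each contains the `d(1,b,1)`, `b ∈ E¹_v`: FILE C `F0P3cStCharTSStLevelsPF.mem_I_of_coe_eq_diagonal`, `I ≤ K₀`, `I ≤ K₁`)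
  have hdI : ∀ b : ↥(normOneUnits (conjLocal L (IsCMField.complexConj L) v)), ∀ g : Gqs L v,
      (g.val.val : Matrix (Fin 3) (Fin 3) (LocalRing L v)) = Matrix.diagonal ![(1 : LocalRing L v), ((b : (LocalRing L v)ˣ) : LocalRing L v), 1] → g ∈ I :=
    fun b g hg => F0P3cStCharTSStLevelsPF.mem_I_of_coe_eq_diagonal L v w hw eA heA hns hϖ g₁ hg₁ K0 K1 I hK0 hK1 hI b g hg
  have e0 : (∀ k ∈ K0, (ψ.comp detZ) k = 1) ↔ ψ = 1 := by
    simp only [MonoidHom.comp_apply]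
    exact comp_detZ_eq_one_on_iff L v hns ι hι detZ hdetZ K0 (fun b g hg => F0P3cStCharTSStLevelsTransport.I_le_K0 L v K0 K1 I hI (hdI b g hg)) ψ
  have e1 : (∀ k ∈ K1, (ψ.comp detZ) k = 1) ↔ ψ = 1 := by
    simp only [MonoidHom.comp_apply]
    exact comp_detZ_eq_one_on_iff L v hns ι hι detZ hdetZ K1 (fun b g hg => F0P3cStCharTSStLevelsTransport.I_le_K1 L v K0 K1 I hI (hdI b g hg)) ψ
  have eI : (∀ k ∈ I, (ψ.comp detZ) k = 1) ↔ ψ = 1 := by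
    simp only [MonoidHom.comp_apply]
    exact comp_detZ_eq_one_on_iff L v hns ι hι detZ hdetZ I hdI ψ
  by_cases hψ1 : ψ = 1
  · rw [if_pos (e0.2 hψ1), if_pos (e1.2 hψ1), if_pos (eI.2 hψ1), if_pos hψ1]; norm_num
  · rw [if_neg (fun h => hψ1 (e0.1 h)), if_neg (fun h => hψ1 (e1.1 h)), if_neg (fun h => hψ1 (eI.1 h)), if_neg hψ1]; norm_num

variable
  (hns : ∀ w' : PlacesOver L v, IsCMField.complexConj L • w'.1 = w'.1) {ϖ : w.1.adicCompletion L}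
  (g₁ : GL (Fin 3) (w.1.adicCompletion L)) (hg₁ : (g₁ : Matrix (Fin 3) (Fin 3) (w.1.adicCompletion L)) = Matrix.diagonal ![(1 : w.1.adicCompletion L), 1, ϖ])
  (K0 K1 I : Subgroup (Gqs L v))
  (hK0 : K0 = ((glInt 3 (w.1.adicCompletion L)).subgroupOf
    (unitaryGroupOfForm (galAdicCompletionMap (L := L) (IsCMField.complexConj L) hw) ((StdForm.antidiagonal 3).over (w.1.adicCompletion L)))).comap
      eA.toMulEquiv.toMonoidHom)
  (hK1 : K1 = (((glInt 3 (w.1.adicCompletion L)).map (MulAut.conj g₁).toMonoidHom).subgroupOf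
    (unitaryGroupOfForm (galAdicCompletionMap (L := L) (IsCMField.complexConj L) hw) ((StdForm.antidiagonal 3).over (w.1.adicCompletion L)))).comap
      eA.toMulEquiv.toMonoidHom)
  (hI : I = K0 ⊓ K1)
  [MeasurableSpace (Gqs L v)] [BorelSpace (Gqs L v)] (νQv : Measure (Gqs L v)) [νQv.IsHaarMeasure]
  (fG : Gqs L v → ℂ)
  (hfG : fG = fun g => (((νQv K0).toReal : ℂ))⁻¹ * (K0 : Set (Gqs L v)).indicator (fun _ => (1 : ℂ)) g +
    (((νQv K1).toReal : ℂ))⁻¹ * (K1 : Set (Gqs L v)).indicator (fun _ => (1 : ℂ)) g -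
    (((νQv I).toReal : ℂ))⁻¹ * (I : Set (Gqs L v)).indicator (fun _ => (1 : ℂ)) g)
  (ι : ↥(normOneUnits (conjLocal L (IsCMField.complexConj L) v)) →* ↥(Subgroup.center (Gqs L v))) (hιc : Continuous ι)
  (hι : ∀ z : ↥(normOneUnits (conjLocal L (IsCMField.complexConj L) v)),
    ((ι z).val.val.val : Matrix (Fin 3) (Fin 3) (LocalRing L v)) = (((z : (LocalRing L v)ˣ) : LocalRing L v)) • (1 : Matrix (Fin 3) (Fin 3) (LocalRing L v)))
  (detZ : Gqs L v →* ↥(Subgroup.center (Gqs L v)))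
  (hdetZ : ∀ g : Gqs L v, ((detZ g).val.val.val : Matrix (Fin 3) (Fin 3) (LocalRing L v)) =
      (g.val.val : Matrix (Fin 3) (Fin 3) (LocalRing L v)).det • (1 : Matrix (Fin 3) (Fin 3) (LocalRing L v)))
  [MeasurableSpace (Gqs L v ⧸ Subgroup.center (Gqs L v))] (μZ : Measure (Gqs L v ⧸ Subgroup.center (Gqs L v)))

/-! ## §1 Twisted traces: `Tr St_G(ψ)(f_{St ψ′}) = [ψ = ψ′]`, `Tr St_G(ψ)(f_{det ψ′}) = −[ψ = ψ′]`, `Tr (ψ∘det_G)(f_{det ψ′}) = [ψ = ψ′]` (letters `stG detG`) -/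

section Letters

variable (stG detG : (↥(Subgroup.center (Gqs L v)) →* ℂˣ) → IrrClass (Gqs L v))
  (hdet : ∀ ψ : ↥(Subgroup.center (Gqs L v)) →* ℂˣ, Continuous ψ →
    ∃ hopen : IsOpen (((ψ.comp detZ).ker : Subgroup (Gqs L v)) : Set (Gqs L v)), detG ψ = IrrClass.mk (SmoothIrrep.ofChar (ψ.comp detZ) hopen))
  (hne : ∀ ψ : ↥(Subgroup.center (Gqs L v)) →* ℂˣ, Continuous ψ → stG ψ ≠ detG ψ)
  (hJH : ∀ ψ : ↥(Subgroup.center (Gqs L v)) →* ℂˣ, Continuous ψ → ∀ c : IrrClass (Gqs L v),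
    c.IsConstituentOf (cmPrincipalSeries L 3 v
      (cmTorusCharPair L v (halfModulusChar (LocalRing L v) * halfModulusChar (LocalRing L v))⁻¹ (ψ.comp ι))) ↔ (c = stG ψ ∨ c = detG ψ))
  (hStL2 : ∀ ψ : ↥(Subgroup.center (Gqs L v)) →* ℂˣ, Continuous ψ → (stG ψ).IsSquareIntegrable μZ)
  (hDet : ∀ ψ : ↥(Subgroup.center (Gqs L v)) →* ℂˣ, Continuous ψ → ¬ (detG ψ).IsSquareIntegrable μZ)

include heA hns hg₁ hK0 hK1 hI hfG hιc hι hdetZ hdet hne hJH hStL2 hDet in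
open Classical in
set_option maxHeartbeats 1600000 in
set_option synthInstance.maxHeartbeats 400000 in
-- instance-path unification between `Gqs L v` and the literal carrier of ★ `cmPrincipalSeries`
/-- **`Tr St_G(ψ)(f_{St ψ′}) = [ψ = ψ′]`**, `f_{St ψ′} = −conj(ψ′∘detZ)·f_EP` (★ CLASS-LINEAR `smoothTrace_mk_neg_conj_character_mul_eq`; ST-TWIST `stG_twist_eq` at the unitary
`conj ψ′`; FILE F `smoothTrace_stG_ep` at `ψ·conj ψ′` and `F0P3cStCharTSEPTraces.mul_conjChar_eq_one_iff`). [cite: Rogawski1990, §12.6 Prop. 12.6.1 (b) p. 188] [cite: BushnellHenniart2006, §9.5 (9.5.1) p. 65] -/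
theorem smoothTrace_stG_epSt (hϖ : Valued.v ϖ = WithZero.exp (-1 : ℤ)) (ψ ψ' : ↥(Subgroup.center (Gqs L v)) →* ℂˣ) (hψ : Continuous ψ) (hψ' : Continuous ψ') :
    (stG ψ).smoothTrace νQv (fun g => -(conj (((ψ' (detZ g)) : ℂˣ) : ℂ) * fG g)) = if ψ = ψ' then 1 else 0 := by
  haveI : NonarchimedeanGroup (Gqs L v) := nonarchimedeanGroup_cmLocal L 3 v
  haveI : LocallyCompactSpace (Gqs L v) := locallyCompactSpace_cmDatum_local (L := L) (N := 3) (H := qsForm L) (v := v)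
  obtain ⟨r, hr⟩ := IrrClass.mk_surjective (stG ψ)
  obtain ⟨hopen', -⟩ := hdet ψ' hψ'
  have hμc : Continuous ⇑((Units.map ((starRingEnd ℂ : ℂ →+* ℂ) : ℂ →* ℂ)).comp ψ') := F0P3cStCharTSEPTraces.continuous_conjChar ψ' hψ'
  have hψμ : Continuous ⇑(ψ * (Units.map ((starRingEnd ℂ : ℂ →+* ℂ) : ℂ →* ℂ)).comp ψ') := by
    show Continuous fun z => ψ z * ((Units.map ((starRingEnd ℂ : ℂ →+* ℂ) : ℂ →* ℂ)).comp ψ') z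
    exact hψ.mul hμc
  have hcl : (IrrClass.mk r).smoothTrace νQv (fun g => -(conj (((ψ' (detZ g)) : ℂˣ) : ℂ) * fG g)) =
      -((IrrClass.twist (((Units.map ((starRingEnd ℂ : ℂ →+* ℂ) : ℂ →* ℂ)).comp ψ').comp detZ) (F0P3cStCharTSEPTraces.isOpen_ker_conjChar_comp L v detZ ψ' hopen')
        (IrrClass.mk r)).smoothTrace νQv fG) :=
    IrrClass.smoothTrace_mk_neg_conj_character_mul_eq νQv (ψ'.comp detZ) hopen' r (isAdmissible_smoothIrrep L v hns r) fG
  have htw := stG_twist_eq L v μZ ι hι detZ hdetZ stG detG hJH hStL2 hDet ψ ((Units.map ((starRingEnd ℂ : ℂ →+* ℂ) : ℂ →* ℂ)).comp ψ') hψ hμc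
    (F0P3cStCharTSEPTraces.norm_conjChar_eq_one L v hns ψ' hψ') (F0P3cStCharTSEPTraces.isOpen_ker_conjChar_comp L v detZ ψ' hopen')
  obtain ⟨hopen'', hdet''⟩ := hdet _ hψμ
  rw [← hr, hcl, hr, htw, smoothTrace_stG_ep L v w hw eA heA hns hϖ g₁ hg₁ K0 K1 I hK0 hK1 hI νQv fG hfG ι hιc hι detZ hdetZ stG detG _ hψμ hopen'' hdet''
    (hne _ hψμ) (hJH _ hψμ), neg_neg]
  by_cases h : ψ = ψ'
  · rw [if_pos ((F0P3cStCharTSEPTraces.mul_conjChar_eq_one_iff L v hns ψ ψ' hψ').2 h), if_pos h]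
  · rw [if_neg (fun h1 => h ((F0P3cStCharTSEPTraces.mul_conjChar_eq_one_iff L v hns ψ ψ' hψ').1 h1)), if_neg h]

include heA hns hg₁ hK0 hK1 hI hfG hιc hι hdetZ hdet hne hJH hStL2 hDet in
open Classical in
set_option maxHeartbeats 1600000 in
set_option synthInstance.maxHeartbeats 400000 in
-- instance-path unification between `Gqs L v` and the literal carrier of ★ `cmPrincipalSeries`
/-- **`Tr St_G(ψ)(f_{det ψ′}) = −[ψ = ψ′]`**, `f_{det ψ′} = conj(ψ′∘detZ)·f_EP` (★ CLASS-LINEAR `smoothTrace_mk_conj_character_mul_eq`; ST-TWIST; FILE F).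
[cite: Rogawski1990, §12.6 Prop. 12.6.1 (b) p. 188] [cite: BushnellHenniart2006, §9.5 (9.5.1) p. 65] -/
theorem smoothTrace_stG_epDet (hϖ : Valued.v ϖ = WithZero.exp (-1 : ℤ)) (ψ ψ' : ↥(Subgroup.center (Gqs L v)) →* ℂˣ) (hψ : Continuous ψ) (hψ' : Continuous ψ') :
    (stG ψ).smoothTrace νQv (fun g => conj (((ψ' (detZ g)) : ℂˣ) : ℂ) * fG g) = -(if ψ = ψ' then 1 else 0) := by
  haveI : NonarchimedeanGroup (Gqs L v) := nonarchimedeanGroup_cmLocal L 3 v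
  haveI : LocallyCompactSpace (Gqs L v) := locallyCompactSpace_cmDatum_local (L := L) (N := 3) (H := qsForm L) (v := v)
  obtain ⟨r, hr⟩ := IrrClass.mk_surjective (stG ψ)
  obtain ⟨hopen', -⟩ := hdet ψ' hψ'
  have hμc : Continuous ⇑((Units.map ((starRingEnd ℂ : ℂ →+* ℂ) : ℂ →* ℂ)).comp ψ') := F0P3cStCharTSEPTraces.continuous_conjChar ψ' hψ'
  have hψμ : Continuous ⇑(ψ * (Units.map ((starRingEnd ℂ : ℂ →+* ℂ) : ℂ →* ℂ)).comp ψ') := by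
    show Continuous fun z => ψ z * ((Units.map ((starRingEnd ℂ : ℂ →+* ℂ) : ℂ →* ℂ)).comp ψ') z
    exact hψ.mul hμc
  have hcl : (IrrClass.mk r).smoothTrace νQv (fun g => conj (((ψ' (detZ g)) : ℂˣ) : ℂ) * fG g) =
      (IrrClass.twist (((Units.map ((starRingEnd ℂ : ℂ →+* ℂ) : ℂ →* ℂ)).comp ψ').comp detZ) (F0P3cStCharTSEPTraces.isOpen_ker_conjChar_comp L v detZ ψ' hopen')
        (IrrClass.mk r)).smoothTrace νQv fG :=
    IrrClass.smoothTrace_mk_conj_character_mul_eq νQv (ψ'.comp detZ) hopen' r (isAdmissible_smoothIrrep L v hns r) fG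
  have htw := stG_twist_eq L v μZ ι hι detZ hdetZ stG detG hJH hStL2 hDet ψ ((Units.map ((starRingEnd ℂ : ℂ →+* ℂ) : ℂ →* ℂ)).comp ψ') hψ hμc
    (F0P3cStCharTSEPTraces.norm_conjChar_eq_one L v hns ψ' hψ') (F0P3cStCharTSEPTraces.isOpen_ker_conjChar_comp L v detZ ψ' hopen')
  obtain ⟨hopen'', hdet''⟩ := hdet _ hψμ
  rw [← hr, hcl, hr, htw, smoothTrace_stG_ep L v w hw eA heA hns hϖ g₁ hg₁ K0 K1 I hK0 hK1 hI νQv fG hfG ι hιc hι detZ hdetZ stG detG _ hψμ hopen'' hdet''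
    (hne _ hψμ) (hJH _ hψμ)]
  by_cases h : ψ = ψ'
  · rw [if_pos ((F0P3cStCharTSEPTraces.mul_conjChar_eq_one_iff L v hns ψ ψ' hψ').2 h), if_pos h]
  · rw [if_neg (fun h1 => h ((F0P3cStCharTSEPTraces.mul_conjChar_eq_one_iff L v hns ψ ψ' hψ').1 h1)), if_neg h]

omit [MeasurableSpace (Gqs L v ⧸ Subgroup.center (Gqs L v))] in
include heA hns hg₁ hK0 hK1 hI hfG hι hdetZ hdet in
open Classical in
/-- **`Tr (ψ∘det_G)(f_{det ψ′}) = [ψ = ψ′]`** (★ CLASS-LINEAR at the representative `𝟙 ⊗ ψ∘detZ`; ST-TWIST `detG_twist_eq`; FILE F `smoothTrace_detG_ep` at `ψ·conj ψ′`).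
[cite: Rogawski1990, §12.6 Prop. 12.6.1 (b) p. 188] [cite: BushnellHenniart2006, §9.5 (9.5.1) p. 65] -/
theorem smoothTrace_detG_epDet (hϖ : Valued.v ϖ = WithZero.exp (-1 : ℤ)) (ψ ψ' : ↥(Subgroup.center (Gqs L v)) →* ℂˣ) (hψ : Continuous ψ) (hψ' : Continuous ψ') :
    (detG ψ).smoothTrace νQv (fun g => conj (((ψ' (detZ g)) : ℂˣ) : ℂ) * fG g) = if ψ = ψ' then 1 else 0 := by
  haveI : NonarchimedeanGroup (Gqs L v) := nonarchimedeanGroup_cmLocal L 3 v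
  haveI : LocallyCompactSpace (Gqs L v) := locallyCompactSpace_cmDatum_local (L := L) (N := 3) (H := qsForm L) (v := v)
  obtain ⟨hopenψ, hdetψ⟩ := hdet ψ hψ
  obtain ⟨hopen', -⟩ := hdet ψ' hψ'
  have hμc : Continuous ⇑((Units.map ((starRingEnd ℂ : ℂ →+* ℂ) : ℂ →* ℂ)).comp ψ') := F0P3cStCharTSEPTraces.continuous_conjChar ψ' hψ'
  have hψμ : Continuous ⇑(ψ * (Units.map ((starRingEnd ℂ : ℂ →+* ℂ) : ℂ →* ℂ)).comp ψ') := by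
    show Continuous fun z => ψ z * ((Units.map ((starRingEnd ℂ : ℂ →+* ℂ) : ℂ →* ℂ)).comp ψ') z
    exact hψ.mul hμc
  obtain ⟨hopen'', hdet''⟩ := hdet _ hψμ
  have hcl : (IrrClass.mk (SmoothIrrep.ofChar (ψ.comp detZ) hopenψ)).smoothTrace νQv (fun g => conj (((ψ' (detZ g)) : ℂˣ) : ℂ) * fG g) =
      (IrrClass.twist (((Units.map ((starRingEnd ℂ : ℂ →+* ℂ) : ℂ →* ℂ)).comp ψ').comp detZ) (F0P3cStCharTSEPTraces.isOpen_ker_conjChar_comp L v detZ ψ' hopen')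
        (IrrClass.mk (SmoothIrrep.ofChar (ψ.comp detZ) hopenψ))).smoothTrace νQv fG :=
    IrrClass.smoothTrace_mk_conj_character_mul_eq νQv (ψ'.comp detZ) hopen' _ (isAdmissible_smoothIrrep L v hns _) fG
  have htw := detG_twist_eq L v detZ detG ψ ((Units.map ((starRingEnd ℂ : ℂ →+* ℂ) : ℂ →* ℂ)).comp ψ') hopenψ
    (F0P3cStCharTSEPTraces.isOpen_ker_conjChar_comp L v detZ ψ' hopen') hopen'' hdetψ hdet''
  rw [hdetψ, hcl, ← hdetψ, htw, smoothTrace_detG_ep L v w hw eA heA hns hϖ g₁ hg₁ K0 K1 I hK0 hK1 hI νQv fG hfG ι hι detZ hdetZ detG _ hopen'' hdet'']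
  by_cases h : ψ = ψ'
  · rw [if_pos ((F0P3cStCharTSEPTraces.mul_conjChar_eq_one_iff L v hns ψ ψ' hψ').2 h), if_pos h]
  · rw [if_neg (fun h1 => h ((F0P3cStCharTSEPTraces.mul_conjChar_eq_one_iff L v hns ψ ψ' hψ').1 h1)), if_neg h]

end Letters

end Summit.HodgeConjecture.HodgeConjecture.Cruxes.H413.F0P3cStCharTSEPTracesPF

end
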